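import Literature.Probability.LatticeModels.CurrentsPartialMonotonicity
import Literature.Probability.LatticeModels.RestrictedCorrelationMonotone
import HarnessLib

/-!
# Connection probabilities of sourceless currents: `P^∅[v ↔ w] ≤ ⟨σ_vσ_w⟩²` and the crossing bound of Aizenman–Duminil-Copin 2021 (Lemma 4.4, (6.12))

Topic `Literature/Probability/LatticeModels`. For edge couplings `K ≥ 0` on a finite simple graph `G`
(`WeightedCurrents.lean`: `ℝ≥0∞` weights `w = Current.eweight K`, pair weights
`epairWeight K A B (n₁,n₂) = 1{∂n₁ = A} 1{∂n₂ = B} w(n₁) w(n₂)`, current sums `Z[A] = ecurrentSum K A`,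
connection indicator `connInd u x (n₁,n₂) = 𝟙[u ∈ C_{n₁+n₂}(x)]` of `CurrentsPartialMonotonicity.lean`),
this file proves the elementary estimate used twice in the proof of the improved tree diagram bound of

* M. Aizenman, H. Duminil-Copin, *Marginal triviality of the scaling limits of critical 4D Ising and
  `φ⁴₄` models*, Ann. of Math. **194** (2021), arXiv:1912.07973 [AizenmanDuminilCopinAnnals2021]:
  proof of **Lemma 4.4** (p. 12), bound on `F₂`: "The remaining current in `n₁` is a sourceless current
  with depleted coupling constants … The probability that some `v ∈ ∂Λ_n` and `w ∈ ∂Λ_m` are connected in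
  `ℤ⁴ ∖ Γ(n₁)` to each other can then be bounded by `⟨σ_vσ_w⟩⟨σ_vσ_w⟩'` where `⟨·⟩'` denotes an Ising
  measure with depleted coupling constants … The Griffiths inequality implies that this probability is
  bounded by `⟨σ_vσ_w⟩²`, which … leads to `P^{0x,∅}[F₂] ≤ ∑_{v ∈ ∂Λ_n, w ∈ ∂Λ_m} ⟨σ_vσ_w⟩²`", and
  proof of **Lemma 6.7**, display (6.12) (p. 25): "the remaining current `n_i ∖ Γ(n_i)` is sourceless.
  Adding an additional sourceless current and using the switching lemma and Griffiths inequality …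
  gives `P^{xy}[n_i ∖ Γ(n_i) crosses Ann(R,N)] ≤ ∑_{v ∈ ∂Λ_R, w ∈ ∂Λ_N} ⟨σ_vσ_w⟩²`",

namely: for a **sourceless** random current with couplings `K' ≤ K` (depleted), the probability that
`v` and `w` are connected is at most `⟨σ_vσ_w⟩²_K`, and the probability that a vertex set `A` is
connected to a vertex set `B` is at most `∑_{a ∈ A, b ∈ B} ⟨σ_aσ_b⟩²_K`. In un-normalised current-sum
form (finite volume, general couplings — so that "depleted coupling constants" are just another `K'`):

* `Current.tsum_epairWeight_empty_empty_mul_connInd` — two independent sourceless currents: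
  `∑ 1{∂n₁=∅}1{∂n₂=∅} w w 𝟙[u ∈ C_{n₁+n₂}(x)] = Z[{x,u}]²`, i.e. `P^{∅,∅}[x ↔ u in n₁+n₂] = ⟨σ_xσ_u⟩²`
  (the switching lemma; the tree's three-point identity with coincident sources);
* `Current.sourcelessConnMass_mul_le` — one sourceless current: with
  `sourcelessConnMass K x u = ∑ 1{∂n=∅} w(n) 𝟙[u ∈ C_n(x)]`,
  `sourcelessConnMass · Z[∅] ≤ Z[{x,u}]²`, i.e. `P^∅[x ↔ u] ≤ ⟨σ_xσ_u⟩²` ("adding an additional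
  sourceless current");
* `Current.sourcelessConnMass_mul_le_of_le` — **depleted couplings** `0 ≤ K' ≤ K`:
  `sourcelessConnMass_{K'} · Z_{K'}[∅] · Z_K[∅]² ≤ Z_K[{x,u}]² · Z_{K'}[∅]²`, i.e.
  `P^∅_{K'}[x ↔ u] ≤ ⟨σ_xσ_u⟩_{K'}² ≤ ⟨σ_xσ_u⟩_K²` (Griffiths' comparison inequality
  `wcurrentSum_mul_le_of_le`);
* `Current.sourcelessCrossMass_mul_le`, `Current.sourcelessCrossMass_mul_le_of_le` — **the crossing
  bound**: with `sourcelessCrossMass K A B = ∑ 1{∂n=∅} w(n) 𝟙[∃ a ∈ A, b ∈ B, b ∈ C_n(a)]`,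
  `sourcelessCrossMass · Z[∅] ≤ ∑_{a ∈ A} ∑_{b ∈ B} Z[{a,b}]²` (union bound), and its depleted form;
  `Current.tsum_epairWeight_empty_empty_mul_crossInd_le` — the same for two sourceless currents.

No named fact is introduced; everything is proved. The backbone conditioning that produces the
sourceless depleted current in the source (the "chain rule for backbones") is not part of this file.

## References

* M. Aizenman, H. Duminil-Copin, Ann. of Math. 194 (2021), arXiv:1912.07973, §4.2, proof of Lemma 4.4
  (bound on `F₂`, `F₃`, p. 12); §6.2, proof of Lemma 6.7, (6.12) (p. 25) [AizenmanDuminilCopinAnnals2021].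
* S. Friedli, Y. Velenik (2017), Thm 3.49 / Ex. 3.31 (GKS comparison) — through
  `RestrictedCorrelationMonotone.lean`.
* R. Panis, arXiv:2309.05797 (2023), §4.1 (three-point identity) — through `WeightedCurrentsIdentities.lean`.
-/

noncomputable section

open Finset Filter
open scoped symmDiff ENNReal

namespace Literature.Probability.LatticeModels

variable {V : Type*} [Fintype V] [DecidableEq V] {G : SimpleGraph V} [DecidableRel G.Adj]

namespace Current

variable {K : G.edgeFinset → ℝ}

/-! ### Two sourceless currents: the switching identity -/

/-- **`P^{∅,∅}[x ↔ u in n₁+n₂] = ⟨σ_xσ_u⟩²`**, current-sum form: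
`∑ 1{∂n₁=∅}1{∂n₂=∅} w w 𝟙[u ∈ C_{n₁+n₂}(x)] = Z[{x,u}]²` (the switching lemma; Aizenman–Duminil-Copin
2021, (6.12): "Adding an additional sourceless current and using the switching lemma").
[cite: AizenmanDuminilCopinAnnals2021, arXiv:1912.07973 §6.2, proof of Lemma 6.7, (6.12) (p. 25)] -/
theorem tsum_epairWeight_empty_empty_mul_connInd (hK : ∀ e, 0 ≤ K e) (x u : V) :
    ∑' p : Current G × Current G, epairWeight K ∅ ∅ p * connInd u x p = ecurrentSum K ({x} ∆ {u}) ^ 2 := by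
  have h := tsum_epairWeight_mul_indicator_mem_cluster hK x x u
  rw [symmDiff_self] at h
  unfold connInd
  rw [show (⊥ : Finset V) = ∅ from rfl] at h
  rw [h, sq]

/-! ### One sourceless current -/

/-- The un-normalised connection mass of a single sourceless current,
`∑ 1{∂n = ∅} w(n) 𝟙[u ∈ C_n(x)]` (`= Z[∅] · P^∅[x ↔ u]`). [cite: AizenmanDuminilCopinAnnals2021, arXiv:1912.07973 §6.2, proof of Lemma 6.7 (the sourceless current n_i ∖ Γ(n_i)) (p. 25)] -/
def sourcelessConnMass (K : G.edgeFinset → ℝ) (x u : V) : ℝ≥0∞ :=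
  ∑' n : Current G, (if n.sources = ∅ then n.eweight K else 0) * (if u ∈ n.cluster x then 1 else 0)

/-- **`P^∅[x ↔ u] ≤ ⟨σ_xσ_u⟩²`** for a sourceless current, current-sum form:
`(∑ 1{∂n=∅} w 𝟙[u ∈ C_n(x)]) · Z[∅] ≤ Z[{x,u}]²` — pair the current with an independent sourceless one,
use `C_{n₁}(x) ⊆ C_{n₁+n₂}(x)` and the switching identity. [cite: AizenmanDuminilCopinAnnals2021, arXiv:1912.07973 §6.2, proof of Lemma 6.7, (6.12) (p. 25); §4.2, proof of Lemma 4.4, bound on F₂ (p. 12)] -/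
theorem sourcelessConnMass_mul_le (hK : ∀ e, 0 ≤ K e) (x u : V) :
    sourcelessConnMass K x u * ecurrentSum K ∅ ≤ ecurrentSum K ({x} ∆ {u}) ^ 2 := by
  rw [← tsum_epairWeight_empty_empty_mul_connInd hK x u]
  unfold sourcelessConnMass ecurrentSum
  rw [tsum_mul_tsum_eq_tsum_prod]
  refine ENNReal.tsum_le_tsum fun p => ?_
  rw [epairWeight_eq_mul]
  unfold connInd
  by_cases h1 : p.1.sources = ∅
  · by_cases h2 : p.2.sources = ∅
    · rw [if_pos h1, if_pos h2]
      by_cases hu : u ∈ p.1.cluster x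
      · rw [if_pos hu, if_pos (cluster_mono (le_self_add : p.1 ≤ p.1 + p.2) x hu)]
        exact le_of_eq (by ring)
      · rw [if_neg hu]; simp
    · rw [if_neg h2]; simp
  · rw [if_neg h1]; simp

/-- Squares of Griffiths' comparison inequality in `ℝ≥0∞`: for `0 ≤ K' ≤ K`,
`Z_{K'}[A]² Z_K[∅]² ≤ Z_K[A]² Z_{K'}[∅]²`. [cite: FriedliVelenik2017, Thm. 3.49 and Exercise 3.31] -/
theorem ecurrentSum_sq_mul_sq_le_of_le {K K' : G.edgeFinset → ℝ} (hK' : ∀ e, 0 ≤ K' e)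
    (hle : ∀ e, K' e ≤ K e) (A : Finset V) :
    ecurrentSum K' A ^ 2 * ecurrentSum K ∅ ^ 2 ≤ ecurrentSum K A ^ 2 * ecurrentSum K' ∅ ^ 2 := by
  have hK : ∀ e, 0 ≤ K e := fun e => (hK' e).trans (hle e)
  have h : ecurrentSum K' A * ecurrentSum K ∅ ≤ ecurrentSum K A * ecurrentSum K' ∅ := by
    rw [ecurrentSum_eq_ofReal hK', ecurrentSum_eq_ofReal hK, ecurrentSum_eq_ofReal hK,
      ecurrentSum_eq_ofReal hK', ← ENNReal.ofReal_mul (wcurrentSum_nonneg hK' A),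
      ← ENNReal.ofReal_mul (wcurrentSum_nonneg hK A)]
    exact ENNReal.ofReal_le_ofReal (wcurrentSum_mul_le_of_le hK' hle A)
  calc ecurrentSum K' A ^ 2 * ecurrentSum K ∅ ^ 2 = (ecurrentSum K' A * ecurrentSum K ∅) ^ 2 := by ring
    _ ≤ (ecurrentSum K A * ecurrentSum K' ∅) ^ 2 := pow_le_pow_left' h 2
    _ = ecurrentSum K A ^ 2 * ecurrentSum K' ∅ ^ 2 := by ring

/-- **Depleted couplings** (Aizenman–Duminil-Copin 2021, proof of Lemma 4.4: "bounded by
`⟨σ_vσ_w⟩⟨σ_vσ_w⟩'` where `⟨·⟩'` denotes an Ising measure with depleted coupling constants … The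
Griffiths inequality implies that this probability is bounded by `⟨σ_vσ_w⟩²`"): for `0 ≤ K' ≤ K`,
`sourcelessConnMass_{K'} · Z_{K'}[∅] · Z_K[∅]² ≤ Z_K[{x,u}]² · Z_{K'}[∅]²`, i.e.
`P^∅_{K'}[x ↔ u] ≤ ⟨σ_xσ_u⟩_K²`. [cite: AizenmanDuminilCopinAnnals2021, arXiv:1912.07973 §4.2, proof of Lemma 4.4, bound on F₂ (p. 12)] -/
theorem sourcelessConnMass_mul_le_of_le {K K' : G.edgeFinset → ℝ} (hK' : ∀ e, 0 ≤ K' e)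
    (hle : ∀ e, K' e ≤ K e) (x u : V) :
    sourcelessConnMass K' x u * ecurrentSum K' ∅ * ecurrentSum K ∅ ^ 2 ≤
      ecurrentSum K ({x} ∆ {u}) ^ 2 * ecurrentSum K' ∅ ^ 2 :=
  calc sourcelessConnMass K' x u * ecurrentSum K' ∅ * ecurrentSum K ∅ ^ 2
      ≤ ecurrentSum K' ({x} ∆ {u}) ^ 2 * ecurrentSum K ∅ ^ 2 :=
        mul_le_mul' (sourcelessConnMass_mul_le hK' x u) le_rfl
    _ ≤ ecurrentSum K ({x} ∆ {u}) ^ 2 * ecurrentSum K' ∅ ^ 2 := ecurrentSum_sq_mul_sq_le_of_le hK' hle _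

/-! ### Crossing: a vertex set connected to another vertex set -/

/-- The indicator of "`A` is connected to `B` in `n`": `𝟙[∃ a ∈ A, b ∈ B, b ∈ C_n(a)]` (for
`A = ∂Λ_R`, `B = ∂Λ_N` the event "`n` crosses `Ann(R,N)`" up to the inclusion of a crossing into a
connection). [cite: AizenmanDuminilCopinAnnals2021, arXiv:1912.07973 §6.2, proof of Lemma 6.7 (the event "n_i ∖ Γ(n_i) crosses Ann(R,N)") (p. 25)] -/
def crossInd (A B : Finset V) (n : Current G) : ℝ≥0∞ :=
  if ∃ a ∈ A, ∃ b ∈ B, b ∈ n.cluster a then 1 else 0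

/-- **The union bound** `𝟙[A ↔ B in n] ≤ ∑_{a ∈ A} ∑_{b ∈ B} 𝟙[b ∈ C_n(a)]`. [folklore] -/
theorem crossInd_le_sum (A B : Finset V) (n : Current G) :
    crossInd A B n ≤ ∑ a ∈ A, ∑ b ∈ B, (if b ∈ n.cluster a then (1 : ℝ≥0∞) else 0) := by
  unfold crossInd
  split_ifs with h
  · obtain ⟨a, ha, b, hb, hab⟩ := h
    calc (1 : ℝ≥0∞) = if b ∈ n.cluster a then (1 : ℝ≥0∞) else 0 := by rw [if_pos hab]
      _ ≤ ∑ b' ∈ B, (if b' ∈ n.cluster a then (1 : ℝ≥0∞) else 0) :=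
          Finset.single_le_sum (f := fun b' => if b' ∈ n.cluster a then (1 : ℝ≥0∞) else 0)
            (fun _ _ => bot_le) hb
      _ ≤ ∑ a' ∈ A, ∑ b' ∈ B, (if b' ∈ n.cluster a' then (1 : ℝ≥0∞) else 0) :=
          Finset.single_le_sum (f := fun a' => ∑ b' ∈ B, (if b' ∈ n.cluster a' then (1 : ℝ≥0∞) else 0))
            (fun _ _ => bot_le) ha
  · exact bot_le

/-- `crossInd` is monotone in the current. [folklore] -/
theorem crossInd_mono {n n' : Current G} (h : n ≤ n') (A B : Finset V) : crossInd A B n ≤ crossInd A B n' := by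
  unfold crossInd
  split_ifs with h1 h2
  · exact le_rfl
  · obtain ⟨a, ha, b, hb, hab⟩ := h1
    exact absurd ⟨a, ha, b, hb, cluster_mono h a hab⟩ h2
  · exact bot_le
  · exact le_rfl

/-- The un-normalised crossing mass of a single sourceless current,
`∑ 1{∂n = ∅} w(n) 𝟙[A ↔ B in n]` (`= Z[∅] · P^∅[A ↔ B]`). [cite: AizenmanDuminilCopinAnnals2021, arXiv:1912.07973 §6.2, proof of Lemma 6.7, (6.12) (p. 25)] -/
def sourcelessCrossMass (K : G.edgeFinset → ℝ) (A B : Finset V) : ℝ≥0∞ :=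
  ∑' n : Current G, (if n.sources = ∅ then n.eweight K else 0) * crossInd A B n

/-- The crossing mass is bounded by the sum of the connection masses. [folklore] -/
theorem sourcelessCrossMass_le_sum (K : G.edgeFinset → ℝ) (A B : Finset V) :
    sourcelessCrossMass K A B ≤ ∑ a ∈ A, ∑ b ∈ B, sourcelessConnMass K a b := by
  unfold sourcelessCrossMass sourcelessConnMass
  calc ∑' n : Current G, (if n.sources = ∅ then n.eweight K else 0) * crossInd A B n
      ≤ ∑' n : Current G, (if n.sources = ∅ then n.eweight K else 0) *
          ∑ a ∈ A, ∑ b ∈ B, (if b ∈ n.cluster a then (1 : ℝ≥0∞) else 0) :=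
        ENNReal.tsum_le_tsum fun n => mul_le_mul' le_rfl (crossInd_le_sum A B n)
    _ = ∑ a ∈ A, ∑ b ∈ B, ∑' n : Current G, (if n.sources = ∅ then n.eweight K else 0) *
          (if b ∈ n.cluster a then (1 : ℝ≥0∞) else 0) := by
        simp_rw [Finset.mul_sum]
        rw [Summable.tsum_finsetSum (fun _ _ => ENNReal.summable)]
        refine Finset.sum_congr rfl fun a _ => ?_
        rw [Summable.tsum_finsetSum (fun _ _ => ENNReal.summable)]

/-- **The crossing bound for a sourceless current** (Aizenman–Duminil-Copin 2021, (6.12):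
"`P^{xy}[n_i ∖ Γ(n_i) crosses Ann(R,N)] ≤ ∑_{v ∈ ∂Λ_R, w ∈ ∂Λ_N} ⟨σ_vσ_w⟩²`", and the bound on
`F₂` in the proof of Lemma 4.4), current-sum form:
`(∑ 1{∂n=∅} w 𝟙[A ↔ B in n]) · Z[∅] ≤ ∑_{a ∈ A} ∑_{b ∈ B} Z[{a,b}]²`, i.e. `P^∅[A ↔ B] ≤ ∑_{a,b} ⟨σ_aσ_b⟩²`.
[cite: AizenmanDuminilCopinAnnals2021, arXiv:1912.07973 §6.2, proof of Lemma 6.7, (6.12) (p. 25)] -/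
theorem sourcelessCrossMass_mul_le (hK : ∀ e, 0 ≤ K e) (A B : Finset V) :
    sourcelessCrossMass K A B * ecurrentSum K ∅ ≤ ∑ a ∈ A, ∑ b ∈ B, ecurrentSum K ({a} ∆ {b}) ^ 2 := by
  calc sourcelessCrossMass K A B * ecurrentSum K ∅
      ≤ (∑ a ∈ A, ∑ b ∈ B, sourcelessConnMass K a b) * ecurrentSum K ∅ :=
        mul_le_mul' (sourcelessCrossMass_le_sum K A B) le_rfl
    _ = ∑ a ∈ A, ∑ b ∈ B, sourcelessConnMass K a b * ecurrentSum K ∅ := by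
        rw [Finset.sum_mul]; simp_rw [Finset.sum_mul]
    _ ≤ ∑ a ∈ A, ∑ b ∈ B, ecurrentSum K ({a} ∆ {b}) ^ 2 :=
        Finset.sum_le_sum fun a _ => Finset.sum_le_sum fun b _ => sourcelessConnMass_mul_le hK a b

/-- **The crossing bound with depleted couplings** `0 ≤ K' ≤ K` (the form in which (6.12) and the
bound on `F₂` are used: the sourceless current lives on the depleted graph, the two-point functions on
the right are those of the full couplings):
`sourcelessCrossMass_{K'} · Z_{K'}[∅] · Z_K[∅]² ≤ (∑_{a,b} Z_K[{a,b}]²) · Z_{K'}[∅]²`, i.e.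
`P^∅_{K'}[A ↔ B] ≤ ∑_{a ∈ A, b ∈ B} ⟨σ_aσ_b⟩_K²`. [cite: AizenmanDuminilCopinAnnals2021, arXiv:1912.07973 §4.2, proof of Lemma 4.4, bound on F₂ (p. 12); §6.2, (6.12) (p. 25)] -/
theorem sourcelessCrossMass_mul_le_of_le {K K' : G.edgeFinset → ℝ} (hK' : ∀ e, 0 ≤ K' e)
    (hle : ∀ e, K' e ≤ K e) (A B : Finset V) :
    sourcelessCrossMass K' A B * ecurrentSum K' ∅ * ecurrentSum K ∅ ^ 2 ≤
      (∑ a ∈ A, ∑ b ∈ B, ecurrentSum K ({a} ∆ {b}) ^ 2) * ecurrentSum K' ∅ ^ 2 := by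
  calc sourcelessCrossMass K' A B * ecurrentSum K' ∅ * ecurrentSum K ∅ ^ 2
      ≤ (∑ a ∈ A, ∑ b ∈ B, sourcelessConnMass K' a b) * ecurrentSum K' ∅ * ecurrentSum K ∅ ^ 2 :=
        mul_le_mul' (mul_le_mul' (sourcelessCrossMass_le_sum K' A B) le_rfl) le_rfl
    _ = ∑ a ∈ A, ∑ b ∈ B, sourcelessConnMass K' a b * ecurrentSum K' ∅ * ecurrentSum K ∅ ^ 2 := by
        rw [Finset.sum_mul, Finset.sum_mul]; simp_rw [Finset.sum_mul]
    _ ≤ ∑ a ∈ A, ∑ b ∈ B, ecurrentSum K ({a} ∆ {b}) ^ 2 * ecurrentSum K' ∅ ^ 2 :=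
        Finset.sum_le_sum fun a _ => Finset.sum_le_sum fun b _ => sourcelessConnMass_mul_le_of_le hK' hle a b
    _ = (∑ a ∈ A, ∑ b ∈ B, ecurrentSum K ({a} ∆ {b}) ^ 2) * ecurrentSum K' ∅ ^ 2 := by
        rw [Finset.sum_mul]; simp_rw [Finset.sum_mul]

/-- **The crossing bound for two independent sourceless currents**:
`∑ 1{∂n₁=∅}1{∂n₂=∅} w w 𝟙[A ↔ B in n₁+n₂] ≤ ∑_{a ∈ A} ∑_{b ∈ B} Z[{a,b}]²`, i.e.
`P^{∅,∅}[A ↔ B in n₁+n₂] ≤ ∑_{a,b} ⟨σ_aσ_b⟩²` (union bound and the switching identity).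
[cite: AizenmanDuminilCopinAnnals2021, arXiv:1912.07973 §4.2, proof of Lemma 4.4, bound on F₂ ("n₁+n₂ contains a cluster crossing Ann(n,m)") (p. 12)] -/
theorem tsum_epairWeight_empty_empty_mul_crossInd_le (hK : ∀ e, 0 ≤ K e) (A B : Finset V) :
    ∑' p : Current G × Current G, epairWeight K ∅ ∅ p * crossInd A B (p.1 + p.2) ≤
      ∑ a ∈ A, ∑ b ∈ B, ecurrentSum K ({a} ∆ {b}) ^ 2 := by
  calc ∑' p : Current G × Current G, epairWeight K ∅ ∅ p * crossInd A B (p.1 + p.2)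
      ≤ ∑' p : Current G × Current G, epairWeight K ∅ ∅ p *
          ∑ a ∈ A, ∑ b ∈ B, (if b ∈ (p.1 + p.2).cluster a then (1 : ℝ≥0∞) else 0) :=
        ENNReal.tsum_le_tsum fun p => mul_le_mul' le_rfl (crossInd_le_sum A B _)
    _ = ∑ a ∈ A, ∑ b ∈ B, ∑' p : Current G × Current G, epairWeight K ∅ ∅ p * connInd b a p := by
        simp_rw [Finset.mul_sum]
        rw [Summable.tsum_finsetSum (fun _ _ => ENNReal.summable)]
        refine Finset.sum_congr rfl fun a _ => ?_
        rw [Summable.tsum_finsetSum (fun _ _ => ENNReal.summable)]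
        rfl
    _ = ∑ a ∈ A, ∑ b ∈ B, ecurrentSum K ({a} ∆ {b}) ^ 2 := by
        refine Finset.sum_congr rfl fun a _ => Finset.sum_congr rfl fun b _ => ?_
        exact tsum_epairWeight_empty_empty_mul_connInd hK a b

end Current

end Literature.Probability.LatticeModels
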